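import Mathlib
import HarnessLib

/-!
# Translates of a function on a finite abelian group: linear independence off the identity
# from non-vanishing of the Fourier coefficients at the non-trivial characters

Support file 2 of the brick «(b) weak Leopoldt over `𝔎_∞`: `Ē_∞ ↪ U_v`» (cell bsd-print-cf2, LEAD
ruling B23 §4 (b)) for crux `PrintCf2RubinValueTwo.TwoVariableMainConjAtSplitTwo`
(stmt-BirchSwinnertonDyer-23720). Namespace `…Theorems.PrintCf2.LeopoldtAtV`. Pure algebra.

This is the character-theoretic step of the Baker–Brumer proof of Leopoldt's conjecture for an
abelian extension `F/K` (Ax 1965; Brumer 1967; Washington §5.5, proof of Thm. 5.25; de Shalit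
1987 III.2.3): for `G = Gal(F/K)` abelian and `f(σ) = log_p τ(σε)` the `G × G` "regulator matrix"
`(f(σρ))_{σ,ρ}` is the matrix of a convolution operator on `L[G]`, diagonalised by the characters
`χ : G → L^×` with eigenvalues the Fourier coefficients `μ_χ(f) = ∑_σ χ(σ) f(σ)`; hence

* `sum_smul_translate_eq` — `∑_ρ χ(ρ) · f(· ρ) = μ_χ(f) · χ⁻¹`;
* `linearIndependent_inv_character` — the functions `χ⁻¹ : G → L` are linearly independent
  (Dedekind–Artin, Mathlib `linearIndependent_monoidHom`);
* `linearIndependent_translate_of_ne_one` — if `μ_χ(f) ≠ 0` for every `χ ≠ 1`, the `#G − 1`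
  translates `σ ↦ f(σρ)`, `ρ ≠ 1`, are linearly independent over `L` (the translate at `ρ = 1` is
  omitted because `μ_1(f) = ∑ f` vanishes in the application: the norm of a unit is torsion).

`L` is any field with enough roots of unity of order the exponent of `G` (e.g. `ℚ̄_p`), so that
`G` has `#G` characters (Mathlib `CommGroup.card_monoidHom_of_hasEnoughRootsOfUnity`).

References: L. C. Washington, *Introduction to Cyclotomic Fields*, GTM 83, §5.5 (Thm. 5.25,
Lemma 5.26); J. Ax, Illinois J. Math. 9 (1965) 584–589; A. Brumer, Mathematika 14 (1967) 121–124.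
-/

noncomputable section

set_option linter.dupNamespace false -- `Summit.BirchSwinnertonDyer.BirchSwinnertonDyer` (summit = problem) is the tree's layout
set_option autoImplicit false

open Module Submodule

namespace Summit.BirchSwinnertonDyer.BirchSwinnertonDyer.Theorems.PrintCf2.LeopoldtAtV

variable {G : Type*} [CommGroup G] [Fintype G] {L : Type*} [Field L]

/-- **Convolution is diagonal on characters**: for `f : G → L` and a character `χ : G → Lˣ`,
`∑_ρ χ(ρ) · (σ ↦ f(σρ)) = μ_χ(f) · χ⁻¹` with `μ_χ(f) = ∑_σ χ(σ) f(σ)`.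
[cite: Washington1997, Lemma 5.26] -/
theorem sum_smul_translate_eq (f : G → L) (χ : G →* Lˣ) :
    ∑ ρ : G, ((χ ρ : Lˣ) : L) • (fun σ : G ↦ f (σ * ρ)) =
      (∑ σ : G, ((χ σ : Lˣ) : L) * f σ) • (fun σ : G ↦ (((χ σ)⁻¹ : Lˣ) : L)) := by
  funext σ
  simp only [Finset.sum_apply, Pi.smul_apply, smul_eq_mul]
  have hreindex : ∑ ρ : G, ((χ (σ * ρ) : Lˣ) : L) * f (σ * ρ) = ∑ t : G, ((χ t : Lˣ) : L) * f t :=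
    Equiv.sum_comp (Equiv.mulLeft σ) (fun t : G ↦ ((χ t : Lˣ) : L) * f t)
  have hχσ : ((χ σ : Lˣ) : L) ≠ 0 := (χ σ).ne_zero
  calc ∑ ρ : G, ((χ ρ : Lˣ) : L) * f (σ * ρ)
      = ∑ ρ : G, (((χ σ)⁻¹ : Lˣ) : L) * (((χ (σ * ρ) : Lˣ) : L) * f (σ * ρ)) := by
        refine Finset.sum_congr rfl fun ρ _ ↦ ?_
        rw [map_mul, Units.val_mul, ← mul_assoc, ← mul_assoc, Units.inv_mul, one_mul]
    _ = (((χ σ)⁻¹ : Lˣ) : L) * ∑ t : G, ((χ t : Lˣ) : L) * f t := by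
        rw [← Finset.mul_sum, hreindex]
    _ = (∑ t : G, ((χ t : Lˣ) : L) * f t) * (((χ σ)⁻¹ : Lˣ) : L) := mul_comm _ _

omit [Fintype G] in
/-- The inverse characters `χ⁻¹ : G → L`, `χ ∈ Hom(G, Lˣ)`, are linearly independent over `L`
(Dedekind–Artin independence of characters). [cite: Washington1997, §5.5] -/
theorem linearIndependent_inv_character :
    LinearIndependent L (fun χ : G →* Lˣ ↦ fun σ : G ↦ (((χ σ)⁻¹ : Lˣ) : L)) := by
  have h := (linearIndependent_monoidHom G L).comp
    (fun χ : G →* Lˣ ↦ (Units.coeHom L).comp χ⁻¹) (by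
      intro χ₁ χ₂ h12
      have h' : ∀ σ, (((χ₁ σ)⁻¹ : Lˣ) : L) = (((χ₂ σ)⁻¹ : Lˣ) : L) := fun σ ↦ by
        have := DFunLike.congr_fun h12 σ
        simpa using this
      ext σ
      have := h' σ
      rw [Units.val_inj, inv_inj] at this
      rw [this])
  have hfun : (fun χ : G →* Lˣ ↦ fun σ : G ↦ (((χ σ)⁻¹ : Lˣ) : L)) =
      ((fun g : G →* L ↦ (g : G → L)) ∘ fun χ : G →* Lˣ ↦ (Units.coeHom L).comp χ⁻¹) := by
    funext χ σ
    simp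
  rw [hfun]
  exact h

/-- There are exactly `#G` characters `G → Lˣ` when `L` has enough roots of unity; in particular
the character group is finite. [cite: Washington1997, §5.5] -/
theorem natCard_character_eq [HasEnoughRootsOfUnity L (Monoid.exponent G)] :
    Nat.card (G →* Lˣ) = Fintype.card G := by
  rw [CommGroup.card_monoidHom_of_hasEnoughRootsOfUnity G L, Nat.card_eq_fintype_card]

/-- **Linear independence of the translates off the identity.** Let `G` be a finite abelian group,
`L` a field with enough roots of unity of order `exp G`, and `f : G → L` with non-vanishing Fourier
coefficient `∑_σ χ(σ) f(σ) ≠ 0` at EVERY non-trivial character `χ`. Then the `#G − 1` translates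
`σ ↦ f(σρ)`, `ρ ≠ 1`, are linearly independent over `L`. (If moreover `∑ f ≠ 0` all `#G` translates
are; if `∑ f = 0` they sum to zero and span the same space.) [cite: Washington1997, Thm. 5.25 (proof) and Lemma 5.26] -/
theorem linearIndependent_translate_of_ne_one [HasEnoughRootsOfUnity L (Monoid.exponent G)]
    (f : G → L) (hχ : ∀ χ : G →* Lˣ, χ ≠ 1 → ∑ σ : G, ((χ σ : Lˣ) : L) * f σ ≠ 0) :
    LinearIndependent L (fun ρ : {ρ : G // ρ ≠ 1} ↦ fun σ : G ↦ f (σ * (ρ : G))) := by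
  classical
  -- the characters form a finite set of cardinality `#G`
  have hcardχ : Nat.card (G →* Lˣ) = Fintype.card G := natCard_character_eq
  haveI : Finite (G →* Lˣ) := Nat.finite_of_card_ne_zero (by rw [hcardχ]; exact Fintype.card_ne_zero)
  letI : Fintype (G →* Lˣ) := Fintype.ofFinite _
  have hcardχ' : Fintype.card (G →* Lˣ) = Fintype.card G := by
    rw [← Nat.card_eq_fintype_card, hcardχ]
  -- notation
  set T : G → (G → L) := fun ρ σ ↦ f (σ * ρ) with hT
  set v : (G →* Lˣ) → (G → L) := fun χ σ ↦ (((χ σ)⁻¹ : Lˣ) : L) with hv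
  set S : Submodule L (G → L) := span L (Set.range T) with hS
  -- (A) every `χ⁻¹` with non-vanishing Fourier coefficient lies in the span of the translates
  have hv_mem : ∀ χ : G →* Lˣ, (∑ σ : G, ((χ σ : Lˣ) : L) * f σ) ≠ 0 → v χ ∈ S := by
    intro χ hμ
    have hid := sum_smul_translate_eq f χ
    have hmem : (∑ ρ : G, ((χ ρ : Lˣ) : L) • T ρ) ∈ S :=
      Submodule.sum_mem _ fun ρ _ ↦ Submodule.smul_mem _ _ (subset_span ⟨ρ, rfl⟩)
    have : v χ = (∑ σ : G, ((χ σ : Lˣ) : L) * f σ)⁻¹ • ∑ ρ : G, ((χ ρ : Lˣ) : L) • T ρ := by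
      rw [hid, smul_smul, inv_mul_cancel₀ hμ, one_smul]
    rw [this]
    exact Submodule.smul_mem _ _ hmem
  -- (B) the `χ⁻¹` are linearly independent
  have hli_v : LinearIndependent L v := linearIndependent_inv_character
  haveI : FiniteDimensional L (G → L) := inferInstance
  -- upper bound for the span of the restricted family
  set T' : {ρ : G // ρ ≠ 1} → (G → L) := fun ρ ↦ T (ρ : G) with hT'
  change LinearIndependent L T'
  have hcard_sub : Fintype.card {ρ : G // ρ ≠ 1} = Fintype.card G - 1 := by
    rw [Fintype.card_subtype_compl, Fintype.card_subtype_eq]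
  -- case split on the Fourier coefficient at the trivial character, `∑ f`
  by_cases h1 : ∑ σ : G, f σ = 0
  · -- the translates sum to zero, so `T 1` lies in the span `S'` of the others and `S' = S`
    have hsum0 : ∑ ρ : G, T ρ = 0 := by
      have hid := sum_smul_translate_eq f (1 : G →* Lˣ)
      simp only [MonoidHom.one_apply, Units.val_one, one_smul, one_mul] at hid
      rw [hid, h1, zero_smul]
    set S' : Submodule L (G → L) := span L (Set.range T') with hS'
    have hT1 : T 1 ∈ S' := by
      have h := Finset.add_sum_erase Finset.univ T (Finset.mem_univ (1 : G))
      rw [hsum0] at h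
      have hT1eq : T 1 = -∑ ρ ∈ Finset.univ.erase (1 : G), T ρ := eq_neg_of_add_eq_zero_left h
      rw [hT1eq]
      refine Submodule.neg_mem _ (Submodule.sum_mem _ fun ρ hρ ↦ ?_)
      exact subset_span ⟨⟨ρ, Finset.ne_of_mem_erase hρ⟩, rfl⟩
    have hSS' : S = S' := by
      refine le_antisymm (span_le.mpr ?_) (span_mono ?_)
      · rintro _ ⟨ρ, rfl⟩
        by_cases hρ : ρ = 1
        · rw [hρ]; exact hT1
        · exact subset_span ⟨⟨ρ, hρ⟩, rfl⟩
      · rintro _ ⟨ρ, rfl⟩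
        exact ⟨(ρ : G), rfl⟩
    -- lower bound: `S` contains the `#G − 1` independent vectors `χ⁻¹`, `χ ≠ 1`
    have hw_mem : ∀ χ : {χ : G →* Lˣ // χ ≠ 1}, v (χ : G →* Lˣ) ∈ S' := fun χ ↦ by
      rw [← hSS']; exact hv_mem χ (hχ χ χ.2)
    let w : {χ : G →* Lˣ // χ ≠ 1} → S' := fun χ ↦ ⟨v χ, hw_mem χ⟩
    have hw_li : LinearIndependent L w := by
      refine LinearIndependent.of_comp S'.subtype ?_
      exact hli_v.comp (fun χ : {χ : G →* Lˣ // χ ≠ 1} ↦ (χ : G →* Lˣ)) Subtype.val_injective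
    have hlow : Fintype.card {χ : G →* Lˣ // χ ≠ 1} ≤ finrank L S' := hw_li.fintype_card_le_finrank
    have hcardχsub : Fintype.card {χ : G →* Lˣ // χ ≠ 1} = Fintype.card G - 1 := by
      rw [Fintype.card_subtype_compl, Fintype.card_subtype_eq, hcardχ']
    have hup : finrank L S' ≤ Fintype.card {ρ : G // ρ ≠ 1} := by
      rw [hS']; exact finrank_range_le_card T'
    rw [linearIndependent_iff_card_eq_finrank_span, Set.finrank, ← hS']
    omega
  · -- all `#G` characters lie in `S`, so the `#G` translates are independent
    have h1' : (∑ σ : G, (((1 : G →* Lˣ) σ : Lˣ) : L) * f σ) ≠ 0 := by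
      simpa using h1
    have hall : ∀ χ : G →* Lˣ, v χ ∈ S := fun χ ↦ by
      by_cases hχ1 : χ = 1
      · rw [hχ1]; exact hv_mem 1 h1'
      · exact hv_mem χ (hχ χ hχ1)
    let w : (G →* Lˣ) → S := fun χ ↦ ⟨v χ, hall χ⟩
    have hw_li : LinearIndependent L w := LinearIndependent.of_comp S.subtype hli_v
    have hlow : Fintype.card (G →* Lˣ) ≤ finrank L S := hw_li.fintype_card_le_finrank
    have hup : finrank L S ≤ Fintype.card G := by rw [hS]; exact finrank_range_le_card T
    have hTli : LinearIndependent L T := by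
      rw [linearIndependent_iff_card_eq_finrank_span, Set.finrank, ← hS]
      omega
    exact hTli.comp (fun ρ : {ρ : G // ρ ≠ 1} ↦ (ρ : G)) Subtype.val_injective

end Summit.BirchSwinnertonDyer.BirchSwinnertonDyer.Theorems.PrintCf2.LeopoldtAtV

end
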